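import Summits.Ventures.YMGap.Conjectures.StrongCouplingChiralLROMesonWeightTimePlane
import HarnessLib
import HarnessLib.Audit.Tags

/-!
# Row S3 of Y3 beyond `β = 0` (4a/4): all reflection planes of the torus, by lattice symmetry

Cell `pub-ymgap`, seat qcd-lit g21 (literature-prover), `bears_on: Q1`.  Everything is a theorem
(0 facts, 0 sorry).  Continuation of `…MesonWeightTimePlane`.

Gaussian domination needs the background weight to be reflection positive for EVERY plane `(i, k)` of
the even torus (the chessboard estimate spreads configurations in all directions).  The time plane
`(0, 1)` is `…MesonWeightTimePlane`; every other plane is conjugate to it by a lattice symmetry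
`g = τ_{(k-1)e_i} ∘ π_{0↔i}` (`planeConj`: swap the axes `0, i`, then translate):
`r_{i,k} ∘ g = g ∘ r_{0,1}` and `g Λ₊^{(0,1)} = Λ₊^{(i,k)}` (`siteReflect_planeConj`,
`planeConj_mem_halfPlus`).  **Transport** (`isRPWeight_of_conj`, any weight, any `N`): a real weight
invariant under `g` and under `r_{0,1}` that is an RP weight for `(0, 1)` is an RP weight for `(i, k)`.
For the background weight `W^bg_β` of the one-flavour theory the invariance under `g` is the invariance
of the meson moments `w_β(m) = S_β(∏σ̂^m)` under translations and axis transpositions — the lattice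
symmetries of the periodic staggered `U(1)` theory on the symmetric torus, taken here as HYPOTHESES
(`hT`, `hP`; their Grassmann/Haar-level proof is separate work) — and `isRPWeight_bgWeight` concludes:
**`W^bg_β` is an RP weight for every plane, at every `β ≥ 0`.**

Honest framing: finite even torus `(ℤ/Lℤ)^ν`, `β ≥ 0`, `N = 1` for the conclusion; nothing about the
continuum or the summit's `QCD` conjunct.

## References
* [SalmhoferSeiler1991] M. Salmhofer, E. Seiler, Commun. Math. Phys. 139 (1991) 395–432, Def. 3.13–3.14,
  (3.91)–(3.93) (chessboard over all planes), Remark 4.5.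
* [FrohlichIsraelLiebSimon1978] J. Fröhlich, R. Israel, E. H. Lieb, B. Simon, Commun. Math. Phys. 62
  (1978) 1–34, §§2–3.
* [MontvayMunster1994] I. Montvay, G. Münster, *Quantum Fields on a Lattice*, CUP 1994, §4.3
  (4.186)–(4.187) (lattice symmetries of staggered fermions).
-/

noncomputable section

open MeasureTheory Finset MvPolynomial
open scoped ComplexConjugate BigOperators ComplexOrder
open Literature.MathematicalPhysics.QuantumFieldTheory (Site Edge GaugeConfig Site.timeReflect)
open Literature.MathematicalPhysics.QuantumLattice
open Literature.MathematicalPhysics.QuantumLattice.StrongCoupling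
open Literature.MathematicalPhysics.StatisticalMechanics
open Literature.MathematicalPhysics.StatisticalMechanics.ComplexSpin
open Literature.Barriers.CriticalPhenomena.NonGibbs
open Literature.Probability.LatticeModels (TorusSite)

namespace Summit.Ventures.YMGap.Conjectures

namespace MesonWeight

open SchwingerDyson

variable {N ν L : ℕ} [NeZero L] [LinearOrder (TorusSite ν L)]

/-! ### Renaming the spins along a bijection, and the bracket -/

omit [NeZero L] [LinearOrder (TorusSite ν L)] in
/-- `rename` passes through the truncated exponential. [cite: SalmhoferSeiler1991, Thm. 3.20 (3.70)] -/
theorem rename_eT (g : TorusSite ν L → TorusSite ν L) (D : ℕ) (P : FieldAlg ν L) :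
    rename g (eT D P) = eT D (rename g P) := by
  unfold eT
  rw [map_sum]
  simp only [map_mul, rename_C, map_pow]

omit [NeZero L] [LinearOrder (TorusSite ν L)] in
/-- Complex conjugation of the coefficients passes through the truncated exponential. [cite: SalmhoferSeiler1991, Thm. 3.20 (3.70)] -/
theorem map_conj_eT (D : ℕ) (P : FieldAlg ν L) :
    MvPolynomial.map (starRingEnd ℂ) (eT D P) = eT D (MvPolynomial.map (starRingEnd ℂ) P) := by
  unfold eT
  rw [map_sum]
  simp only [map_mul, map_C, map_pow, map_inv₀, map_natCast]

omit [LinearOrder (TorusSite ν L)] in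
/-- `rename g (e_D^{-σ_xσ_y}) = e_D^{-σ_{gx}σ_{gy}}`. [cite: SalmhoferSeiler1991, (3.78)] -/
theorem rename_bondTerm [NeZero ν] (g : TorusSite ν L → TorusSite ν L) (x y : TorusSite ν L) :
    rename g (bondTerm x y) = bondTerm (g x) (g y) := by
  rw [bondTerm, bondTerm, rename_eT, map_mul, map_pow, map_mul, rename_X, rename_X, rename_C]

omit [LinearOrder (TorusSite ν L)] in
/-- The bond factors have real coefficients. [cite: SalmhoferSeiler1991, (3.78)] -/
theorem map_conj_bondTerm [NeZero ν] (x y : TorusSite ν L) :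
    MvPolynomial.map (starRingEnd ℂ) (bondTerm x y) = bondTerm x y := by
  rw [bondTerm, map_conj_eT, map_mul, map_pow, map_mul, map_X, map_X, map_C, map_neg, map_natCast]

omit [LinearOrder (TorusSite ν L)] in
/-- The bond factor has real coefficients. [cite: SalmhoferSeiler1991, (3.78)] -/
theorem map_conj_bondFactor [NeZero ν] : MvPolynomial.map (starRingEnd ℂ) (bondFactor ν L) = bondFactor ν L := by
  rw [bondFactor_eq_prod_edges, map_prod]
  exact Finset.prod_congr rfl fun e _ => map_conj_bondTerm e.1 _

omit [LinearOrder (TorusSite ν L)] in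
/-- The top exponent is invariant under bijections. [cite: SalmhoferSeiler1991, Remark 3.2] -/
theorem mapDomain_topExponent (g : TorusSite ν L ≃ TorusSite ν L) :
    Finsupp.mapDomain g (topExponent (ν := ν) (L := L) N) = topExponent N := by
  ext x
  obtain ⟨y, rfl⟩ := g.surjective x
  rw [Finsupp.mapDomain_apply g.injective, topExponent_apply', topExponent_apply']

omit [LinearOrder (TorusSite ν L)] in
/-- **A symmetry of the weight is a symmetry of its bracket**: `[P ∘ g]_V = [P]_V` if `V ∘ g = V`. [cite: SalmhoferSeiler1991, Remark 3.2] -/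
theorem bracketW_rename {M : ℕ} {V : FieldAlg ν L} (g : TorusSite ν L ≃ TorusSite ν L) (hV : rename g V = V)
    (P : FieldAlg ν L) : bracketW M V (rename g P) = bracketW M V P := by
  rw [bracketW, bracketW]
  conv_lhs => rw [← hV, ← map_mul, ← mapDomain_topExponent (N := M) g]
  exact coeff_rename_mapDomain _ g.injective _ _

/-! ### Transport of reflection positivity along a lattice symmetry -/

omit [LinearOrder (TorusSite ν L)] in
/-- **Transport.**  Let `g` be a bijection of the torus conjugating the time plane `(0, 1)` to the plane
`(i, k)` (`r_{i,k} ∘ g = g ∘ r_{0,1}`, `g⁻¹ Λ₊^{(i,k)} = Λ₊^{(0,1)}`), and `V` a weight with real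
coefficients invariant under `g` and under `r_{0,1}`.  If `V` is an RP weight for `(0, 1)` it is an RP
weight for `(i, k)`. [cite: FrohlichIsraelLiebSimon1978, §2] -/
theorem isRPWeight_of_conj [NeZero ν] {M : ℕ} {V : FieldAlg ν L} (i : Fin ν) (k : ZMod L)
    (g : TorusSite ν L ≃ TorusSite ν L)
    (hg₁ : ∀ x, siteReflect i k (g x) = g (siteReflect (0 : Fin ν) 1 x))
    (hg₂ : ∀ x, g x ∈ halfPlus L i k ↔ x ∈ halfPlus L (0 : Fin ν) 1)
    (hVc : MvPolynomial.map (starRingEnd ℂ) V = V) (hVg : rename g V = V)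
    (hV0 : rename (siteReflect (0 : Fin ν) 1) V = V) (h01 : IsRPWeight (0 : Fin ν) 1 M V) :
    IsRPWeight i k M V := by
  classical
  have hsg : (⇑g.symm ∘ ⇑g) = id := funext fun x => g.symm_apply_apply x
  have hgs : (⇑g ∘ ⇑g.symm) = id := funext fun x => g.apply_symm_apply x
  have hginv : rename g.symm V = V := by
    conv_lhs => rw [← hVg]
    rw [rename_rename, hsg, rename_id, AlgHom.id_apply]
  have hfun : (⇑(siteReflect i k) : TorusSite ν L → TorusSite ν L) = (⇑g ∘ ⇑(siteReflect (0 : Fin ν) 1)) ∘ ⇑g.symm := by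
    funext x
    simp only [Function.comp_apply]
    rw [← hg₁, g.apply_symm_apply]
  have hconj : ∀ P : FieldAlg ν L, rename (siteReflect i k) P =
      rename g (rename (siteReflect (0 : Fin ν) 1) (rename g.symm P)) := by
    intro P
    rw [rename_rename, rename_rename, ← hfun]
  refine ⟨?_, fun {A} hA => ?_⟩
  · rw [reflect_apply, hVc, hconj, hginv, hV0, hVg]
  · set A₀ := rename g.symm A with hA₀
    have hmem : A₀ ∈ plusAlgebra (0 : Fin ν) 1 := by
      rw [plusAlgebra, mem_supported] at hA ⊢
      intro y hy
      obtain ⟨x, hx, rfl⟩ := Finset.mem_image.1 (vars_rename g.symm A (Finset.mem_coe.1 hy))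
      have hx' := (hg₂ (g.symm x))
      rw [g.apply_symm_apply] at hx'
      exact Finset.mem_coe.2 (hx'.1 (Finset.mem_coe.1 (hA (Finset.mem_coe.2 hx))))
    have hAeq : A = rename g A₀ := by rw [hA₀, rename_rename, hgs, rename_id, AlgHom.id_apply]
    have hrefl : reflect i k A = rename g (reflect (0 : Fin ν) 1 A₀) := by
      rw [reflect_apply, reflect_apply, hconj, map_rename]
    have hprod : A * reflect i k A = rename g (A₀ * reflect (0 : Fin ν) 1 A₀) := by
      rw [hrefl, map_mul, ← hAeq]
    rw [hprod, bracketW_rename g hVg]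
    exact h01.nonneg hmem

/-! ### Every plane of the torus is conjugate to the time plane -/

variable [NeZero ν]

omit [NeZero L] in
/-- The transposition of the axes `0` and `i`, acting on sites. [cite: MontvayMunster1994, §4.3] -/
def axisSwap (i : Fin ν) : TorusSite ν L ≃ TorusSite ν L where
  toFun x := x ∘ Equiv.swap 0 i
  invFun x := x ∘ Equiv.swap 0 i
  left_inv x := by funext j; simp [Equiv.swap_apply_self]
  right_inv x := by funext j; simp [Equiv.swap_apply_self]

omit [NeZero L] [LinearOrder (TorusSite ν L)] in
/-- `axisSwap` pointwise. [cite: MontvayMunster1994, §4.3] -/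
theorem axisSwap_apply (i : Fin ν) (x : TorusSite ν L) (j : Fin ν) : axisSwap i x j = x (Equiv.swap 0 i j) := rfl

/-- The symmetry `g = τ_{(k-1)e_i} ∘ π_{0↔i}` conjugating the time plane to the plane `(i, k)`. [cite: SalmhoferSeiler1991, Def. 3.13] -/
def planeConj (i : Fin ν) (k : ZMod L) : TorusSite ν L ≃ TorusSite ν L :=
  (axisSwap i).trans (Equiv.addRight (Pi.single i (k - 1)))

omit [NeZero L] [LinearOrder (TorusSite ν L)] in
/-- `planeConj` pointwise. [cite: SalmhoferSeiler1991, Def. 3.13] -/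
theorem planeConj_apply (i : Fin ν) (k : ZMod L) (x : TorusSite ν L) (j : Fin ν) :
    planeConj i k x j = x (Equiv.swap 0 i j) + (Pi.single i (k - 1) : TorusSite ν L) j := rfl

omit [NeZero L] [LinearOrder (TorusSite ν L)] in
/-- **`r_{i,k} ∘ g = g ∘ r_{0,1}`.** [cite: SalmhoferSeiler1991, Def. 3.13] -/
theorem siteReflect_planeConj (i : Fin ν) (k : ZMod L) (x : TorusSite ν L) :
    siteReflect i k (planeConj i k x) = planeConj i k (siteReflect (0 : Fin ν) 1 x) := by
  funext j
  by_cases hj : j = i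
  · subst hj
    rw [siteReflect_apply_same, planeConj_apply, planeConj_apply, Pi.single_eq_same, Equiv.swap_apply_right,
      siteReflect_apply_same]
    ring
  · have hsj : Equiv.swap (0 : Fin ν) i j ≠ 0 := by
      intro h
      rw [Equiv.swap_apply_eq_iff, Equiv.swap_apply_left] at h
      exact hj h
    rw [siteReflect_apply_of_ne _ _ _ hj, planeConj_apply, planeConj_apply, Pi.single_eq_of_ne hj,
      siteReflect_apply_of_ne _ _ _ hsj]

omit [LinearOrder (TorusSite ν L)] in
/-- **`g Λ₊^{(0,1)} = Λ₊^{(i,k)}`.** [cite: SalmhoferSeiler1991, Def. 3.13] -/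
theorem planeConj_mem_halfPlus (i : Fin ν) (k : ZMod L) (x : TorusSite ν L) :
    planeConj i k x ∈ halfPlus L i k ↔ x ∈ halfPlus L (0 : Fin ν) 1 := by
  rw [mem_halfPlus, mem_halfPlus, planeConj_apply, Pi.single_eq_same, Equiv.swap_apply_right,
    show x 0 + (k - 1) - k = x 0 - 1 by ring]

omit [NeZero L] [LinearOrder (TorusSite ν L)] in
/-- `e_μ ∘ π_{0↔i} = e_{π μ}`. [cite: MontvayMunster1994, §4.3] -/
theorem single_comp_swap (i μ : Fin ν) :
    ((Pi.single μ (1 : ZMod L) : TorusSite ν L) ∘ Equiv.swap 0 i) = Pi.single (Equiv.swap 0 i μ) 1 := by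
  funext j
  simp only [Function.comp_apply, Pi.single_apply]
  by_cases h : Equiv.swap (0 : Fin ν) i j = μ
  · rw [if_pos h, if_pos (by rw [← h, Equiv.swap_apply_self])]
  · rw [if_neg h, if_neg (fun h' => h (by rw [h', Equiv.swap_apply_self]))]

omit [LinearOrder (TorusSite ν L)] [NeZero ν] in
/-- The bond factor, unfolded. [cite: SalmhoferSeiler1991, (3.78)] -/
theorem bondFactor_eq : bondFactor ν L = ∏ x : TorusSite ν L, ∏ μ : Fin ν, bondTerm x (x + Pi.single μ 1) := rfl

omit [LinearOrder (TorusSite ν L)] in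
/-- The bond factor is translation invariant. [cite: MontvayMunster1994, §4.3 (4.186)] -/
theorem rename_bondFactor_addRight (c : TorusSite ν L) :
    rename (Equiv.addRight c) (bondFactor ν L) = bondFactor ν L := by
  rw [bondFactor_eq, map_prod]
  have hF : ∀ x : TorusSite ν L, rename (Equiv.addRight c) (∏ μ : Fin ν, bondTerm x (x + Pi.single μ 1)) =
      (fun y : TorusSite ν L => ∏ μ : Fin ν, bondTerm y (y + Pi.single μ 1)) (Equiv.addRight c x) := by
    intro x
    rw [map_prod]
    refine Finset.prod_congr rfl fun μ _ => ?_
    rw [rename_bondTerm, Equiv.coe_addRight, add_right_comm]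
  exact (Finset.prod_congr rfl fun x _ => hF x).trans (Fintype.prod_equiv (Equiv.addRight c) _ _ fun x => rfl)

omit [LinearOrder (TorusSite ν L)] in
/-- The bond factor is invariant under axis transpositions. [cite: MontvayMunster1994, §4.3 (4.187)] -/
theorem rename_bondFactor_axisSwap (i : Fin ν) :
    rename (axisSwap (L := L) i) (bondFactor ν L) = bondFactor ν L := by
  have h : ∀ (x : TorusSite ν L) (μ : Fin ν),
      axisSwap i (x + Pi.single μ 1) = axisSwap i x + Pi.single (Equiv.swap 0 i μ) 1 := by
    intro x μ
    show (x + Pi.single μ 1) ∘ Equiv.swap 0 i = x ∘ Equiv.swap 0 i + Pi.single (Equiv.swap 0 i μ) 1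
    rw [← single_comp_swap]; rfl
  rw [bondFactor_eq, map_prod]
  have hF : ∀ x : TorusSite ν L, rename (axisSwap i) (∏ μ : Fin ν, bondTerm x (x + Pi.single μ 1)) =
      (fun y : TorusSite ν L => ∏ μ : Fin ν, bondTerm y (y + Pi.single μ 1)) (axisSwap i x) := by
    intro x
    rw [map_prod]
    exact (Finset.prod_congr rfl fun μ _ => by rw [rename_bondTerm, h]).trans
      (Fintype.prod_equiv (Equiv.swap (0 : Fin ν) i) _
        (fun μ => bondTerm (axisSwap i x) (axisSwap i x + Pi.single μ 1)) fun μ => rfl)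
  exact (Finset.prod_congr rfl fun x _ => hF x).trans (Fintype.prod_equiv (axisSwap i) _ _ fun x => rfl)

omit [LinearOrder (TorusSite ν L)] in
/-- The bond factor is invariant under `planeConj`. [cite: MontvayMunster1994, §4.3] -/
theorem rename_bondFactor_planeConj (i : Fin ν) (k : ZMod L) :
    rename (planeConj i k) (bondFactor ν L) = bondFactor ν L := by
  rw [planeConj, Equiv.coe_trans, ← rename_rename, rename_bondFactor_axisSwap, rename_bondFactor_addRight]

omit [LinearOrder (TorusSite ν L)] in
/-- The bond factor is invariant under the time reflection (as a renaming). [cite: SalmhoferSeiler1991, (3.84)–(3.89)] -/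
theorem rename_siteReflect_bondFactor (hL : Even L) :
    rename (siteReflect (0 : Fin ν) 1) (bondFactor ν L) = bondFactor ν L := by
  have h := reflect_bondFactor (ν := ν) hL
  rwa [reflect_apply, map_conj_bondFactor] at h

/-- The meson weight is invariant under the time reflection (as a renaming). [cite: FrohlichIsraelLiebSimon1978, §2] -/
theorem rename_siteReflect_mesonWeightC (hL : Even L) {β : ℝ} (hβ : 0 ≤ β) :
    rename (siteReflect (0 : Fin ν) 1) (mesonWeightC N ν L β) = mesonWeightC N ν L β := by
  have h := reflect_mesonWeightC (N := N) (ν := ν) hL hβ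
  rwa [reflect_apply, map_conj_mesonWeightC hL] at h

/-- **THE BACKGROUND WEIGHT OF COMPACT LATTICE QED (one staggered fermion) IS A REFLECTION-POSITIVE WEIGHT
FOR EVERY PLANE OF THE EVEN TORUS, AT EVERY `β ≥ 0`**, granted the invariance of the meson moments
`w_β(m) = S_β(∏σ̂^m)` under lattice translations (`hT`) and axis transpositions (`hP`). [cite: SalmhoferSeiler1991, Remark 4.5 and (3.90)–(3.93)] -/
theorem isRPWeight_bgWeight (hL : Even L) {β : ℝ} (hβ : 0 ≤ β)
    (hT : ∀ (c : TorusSite ν L) (m : TorusSite ν L →₀ ℕ),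
      mesonMoment 1 ν L β (Finsupp.mapDomain (Equiv.addRight c) m) = mesonMoment 1 ν L β m)
    (hP : ∀ (i : Fin ν) (m : TorusSite ν L →₀ ℕ),
      mesonMoment 1 ν L β (Finsupp.mapDomain (axisSwap i) m) = mesonMoment 1 ν L β m)
    (i : Fin ν) (k : ZMod L) : IsRPWeight i k 1 (bgWeight ν L β) := by
  refine isRPWeight_of_conj i k (planeConj i k) (siteReflect_planeConj i k) (planeConj_mem_halfPlus i k)
    ?_ ?_ ?_ (isRPWeight_bgWeight_zero_one hL hβ)
  · rw [bgWeight, map_mul, map_conj_mesonWeightC hL, map_conj_bondFactor]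
  · rw [bgWeight, map_mul, rename_bondFactor_planeConj,
      rename_mesonWeightC β (planeConj i k) fun m => by
        rw [planeConj, Equiv.coe_trans, Finsupp.mapDomain_comp, hT, hP]]
  · rw [bgWeight, map_mul, rename_siteReflect_mesonWeightC hL hβ, rename_siteReflect_bondFactor hL]

end MesonWeight

end Summit.Ventures.YMGap.Conjectures

end
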